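import Summits.ValiantsHypothesis.ValiantsHypothesis.Theses.UlrichPadded
import Literature.Computability.AlgebraicComplexity.StandardFamiliesProofs
import Literature.Computability.AlgebraicComplexity.RankOneDeterminantalExpressionsProofs

/-!
# `UlrichPadded.RankOneTrivialisation` (stmt-ValiantsHypothesis-5667): load-bearing hypotheses

Negative knowledge for the crux (standing disprover, 2026-08-15): the statement
"`adj A ≡ c wᵀ (mod per_n)` with `deg c + deg w ≤ m - 1` for every affine determinantal representation
`A` of `per_n`, `n ≥ 3`" becomes FALSE when either of its two hypotheses is weakened —

* `rankOneTrivialisation_false_at_two`: with `3 ≤ n` weakened to `2 ≤ n` it fails for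
  `per₂ = det [[x₀₀, -x₀₁], [x₁₀, x₁₁]]` (the quadric cone `ℂ[x]/(per₂)` is not factorial; `adj` consists of
  four independent linear forms, and `dc + dw ≤ 1` forces one factor to be constant);
* `rankOneTrivialisation_false_nonaffine`: with "affine entries" dropped (only `det A = per_n`) it fails
  for the `2 × 2` matrix `[[x₀₀, 1], [x₀₀·k - per₃, k]]`, `k = x₁₁x₂₂ + x₂₁x₁₂` (for entries of degree `≤ d`
  the graded argument only yields `dc + dw ≤ d(m - 1)`).

So any proof must use `n ≥ 3` (it enters through factoriality of `ℂ[x]/(per_n)`, crux 5666) and the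
degree-one grading (homogenisation `x₀A₀ + L(x)`).  Both theorems are stated inline (no new facts).
-/

noncomputable section

namespace Summit.ValiantsHypothesis.Theorems.RankOneTrivialisationNegative

open MvPolynomial Matrix
open Literature.Computability.AlgebraicComplexity

/-- A multiple of `per_n` of total degree `< n` is zero (`per_n` is a nonzero form of degree `n` and
`ℂ[x]` is a domain). [folklore] -/
theorem eq_zero_of_mem_span_perPoly {n : ℕ} {q : MvPolynomial (Fin n × Fin n) ℂ}
    (hq : q ∈ Ideal.span {perPoly (Fin n) ℂ}) (hdeg : q.totalDegree < n) : q = 0 := by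
  obtain ⟨k, rfl⟩ := Ideal.mem_span_singleton.1 hq
  by_contra hne
  have hk : k ≠ 0 := by
    rintro rfl
    exact hne (mul_zero _)
  have hper : perPoly (Fin n) ℂ ≠ 0 := perPoly_ne_zero (Fin n) ℂ
  have hdegper : (perPoly (Fin n) ℂ).totalDegree = n := by
    simpa [Fintype.card_fin] using
      (perPoly_isHomogeneous (n := Fin n) (k := ℂ)).totalDegree hper
  rw [totalDegree_mul_of_isDomain hper hk, hdegper] at hdeg
  omega

/-- `1 ∉ (per_n)` for `n ≥ 1`. [folklore] -/
theorem one_notMem_span_perPoly {n : ℕ} (hn : 1 ≤ n) :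
    (1 : MvPolynomial (Fin n × Fin n) ℂ) ∉ Ideal.span {perPoly (Fin n) ℂ} := fun h =>
  one_ne_zero (eq_zero_of_mem_span_perPoly h (by rw [totalDegree_one]; omega))

/-- `X a ∉ (per_n)` for `n ≥ 2`. [folklore] -/
theorem X_notMem_span_perPoly {n : ℕ} (hn : 2 ≤ n) (a : Fin n × Fin n) :
    (X a : MvPolynomial (Fin n × Fin n) ℂ) ∉ Ideal.span {perPoly (Fin n) ℂ} := fun h =>
  X_ne_zero a (eq_zero_of_mem_span_perPoly h (by rw [totalDegree_X]; omega))

/-- **`3 ≤ n` is load-bearing in `RankOneTrivialisation`.** The crux with `2 ≤ n` in place of `3 ≤ n`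
(everything else verbatim) is false: witness `n = m = 2`, `A₂ = [[x₀₀, -x₀₁], [x₁₀, x₁₁]]`,
`det A₂ = per₂`, `adj A₂ = [[x₁₁, x₀₁], [-x₁₀, x₀₀]]`; with `dc + dw ≤ 1` one of `c, w` is constant,
forcing two independent linear forms to be proportional modulo the quadric. [folklore] -/
theorem rankOneTrivialisation_false_at_two :
    ¬ ∀ n : ℕ, 2 ≤ n → ∀ (m : ℕ) (A : Matrix (Fin m) (Fin m) (MvPolynomial (Fin n × Fin n) ℂ)),
      IsAffineDetRepr (perPoly (Fin n) ℂ) A →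
      ∃ (c w : Fin m → MvPolynomial (Fin n × Fin n) ℂ) (dc dw : ℕ), dc + dw ≤ m - 1 ∧
        (∀ i, (c i).totalDegree ≤ dc) ∧ (∀ i, (w i).totalDegree ≤ dw) ∧
        ∀ i j, A.adjugate i j - c i * w j ∈ Ideal.span {perPoly (Fin n) ℂ} := by
  intro h
  obtain ⟨A₂, hA₂⟩ : ∃ M : Matrix (Fin 2) (Fin 2) (MvPolynomial (Fin 2 × Fin 2) ℂ),
      M = !![X (0, 0), -X (0, 1); X (1, 0), X (1, 1)] := ⟨_, rfl⟩
  have hper2 : perPoly (Fin 2) ℂ = X (0, 0) * X (1, 1) + X (1, 0) * X (0, 1) := by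
    simp [perPoly, permanent_fin_two, Matrix.mvPolynomialX_apply]
  have hrepr : IsAffineDetRepr (perPoly (Fin 2) ℂ) A₂ := by
    refine ⟨fun i j => ?_, ?_⟩
    · rw [hA₂]
      fin_cases i <;> fin_cases j <;> simp [totalDegree_X, totalDegree_neg]
    · rw [Matrix.det_fin_two, hper2, hA₂]
      simp
      ring
  obtain ⟨c, w, dc, dw, hsum, hc, hw, hmem⟩ := h 2 le_rfl 2 A₂ hrepr
  have hadj : A₂.adjugate = !![X (1, 1), X (0, 1); -X (1, 0), X (0, 0)] := by
    rw [Matrix.adjugate_fin_two, hA₂]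
    simp
  have low : ∀ q : MvPolynomial (Fin 2 × Fin 2) ℂ, q ∈ Ideal.span {perPoly (Fin 2) ℂ} →
      q.totalDegree < 2 → q = 0 := fun q hq hd => eq_zero_of_mem_span_perPoly hq hd
  have h00 := hmem 0 0
  have h10 := hmem 1 0
  have h01 := hmem 0 1
  simp only [hadj, Matrix.of_apply, Matrix.cons_val', Matrix.cons_val_zero, Matrix.cons_val_one,
    Matrix.empty_val', Matrix.cons_val_fin_one] at h00 h10 h01
  have hdeg1 : ∀ (a b : ℂ) (u v : Fin 2 × Fin 2),
      (C b * X u + C a * X v : MvPolynomial (Fin 2 × Fin 2) ℂ).totalDegree < 2 := by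
    intro a b u v
    refine lt_of_le_of_lt ((totalDegree_add _ _).trans (max_le ?_ ?_)) one_lt_two <;>
      exact (totalDegree_mul _ _).trans (by simp [totalDegree_X])
  rcases (show dc = 0 ∨ dw = 0 by omega) with hdc | hdw
  · subst hdc
    have hc0 : c 0 = C (coeff 0 (c 0)) := totalDegree_eq_zero_iff_eq_C.1 (Nat.le_zero.1 (hc 0))
    have hc1 : c 1 = C (coeff 0 (c 1)) := totalDegree_eq_zero_iff_eq_C.1 (Nat.le_zero.1 (hc 1))
    set a := coeff 0 (c 0)
    set b := coeff 0 (c 1)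
    have hq : (C b * X (1, 1) + C a * X (1, 0) : MvPolynomial (Fin 2 × Fin 2) ℂ) ∈
        Ideal.span {perPoly (Fin 2) ℂ} := by
      have := Ideal.sub_mem _ (Ideal.mul_mem_left _ (C b) h00) (Ideal.mul_mem_left _ (C a) h10)
      convert this using 1
      rw [hc0, hc1]
      ring
    have hq0 := low _ hq (hdeg1 a b _ _)
    have hb : b = 0 := by
      simpa using congr_arg (eval fun ij : Fin 2 × Fin 2 => if ij = (1, 1) then (1 : ℂ) else 0) hq0
    have ha : a = 0 := by
      simpa using congr_arg (eval fun ij : Fin 2 × Fin 2 => if ij = (1, 0) then (1 : ℂ) else 0) hq0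
    have hX : (X (1, 1) : MvPolynomial (Fin 2 × Fin 2) ℂ) ∈ Ideal.span {perPoly (Fin 2) ℂ} := by
      have := h00
      rw [hc0, ha] at this
      simpa using this
    exact X_notMem_span_perPoly le_rfl _ hX
  · subst hdw
    have hw0 : w 0 = C (coeff 0 (w 0)) := totalDegree_eq_zero_iff_eq_C.1 (Nat.le_zero.1 (hw 0))
    have hw1 : w 1 = C (coeff 0 (w 1)) := totalDegree_eq_zero_iff_eq_C.1 (Nat.le_zero.1 (hw 1))
    set a := coeff 0 (w 0)
    set b := coeff 0 (w 1)
    have hq : (C b * X (1, 1) + C (-a) * X (0, 1) : MvPolynomial (Fin 2 × Fin 2) ℂ) ∈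
        Ideal.span {perPoly (Fin 2) ℂ} := by
      have := Ideal.sub_mem _ (Ideal.mul_mem_left _ (C b) h00) (Ideal.mul_mem_left _ (C a) h01)
      convert this using 1
      rw [hw0, hw1, C_neg]
      ring
    have hq0 := low _ hq (hdeg1 (-a) b _ _)
    have hb : b = 0 := by
      simpa using congr_arg (eval fun ij : Fin 2 × Fin 2 => if ij = (1, 1) then (1 : ℂ) else 0) hq0
    have ha : a = 0 := by
      simpa using congr_arg (eval fun ij : Fin 2 × Fin 2 => if ij = (0, 1) then (1 : ℂ) else 0) hq0
    have hX : (X (1, 1) : MvPolynomial (Fin 2 × Fin 2) ℂ) ∈ Ideal.span {perPoly (Fin 2) ℂ} := by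
      have := h00
      rw [hw0, ha] at this
      simpa using this
    exact X_notMem_span_perPoly le_rfl _ hX

/-- **Affineness is load-bearing in `RankOneTrivialisation`.** The crux with `IsAffineDetRepr`
weakened to `det A = per_n` is false: witness `n = 3`, `m = 2`,
`N₃ = [[x₀₀, 1], [x₀₀·k - per₃, k]]`, `k = x₁₁x₂₂ + x₂₁x₁₂`, `adj N₃ ≡ (1, -x₀₀)ᵀ (k, -1) (mod per₃)`
needs `deg c + deg w = 3 > m - 1 = 1`. [folklore] -/
theorem rankOneTrivialisation_false_nonaffine :
    ¬ ∀ n : ℕ, 3 ≤ n → ∀ (m : ℕ) (A : Matrix (Fin m) (Fin m) (MvPolynomial (Fin n × Fin n) ℂ)),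
      A.det = perPoly (Fin n) ℂ →
      ∃ (c w : Fin m → MvPolynomial (Fin n × Fin n) ℂ) (dc dw : ℕ), dc + dw ≤ m - 1 ∧
        (∀ i, (c i).totalDegree ≤ dc) ∧ (∀ i, (w i).totalDegree ≤ dw) ∧
        ∀ i j, A.adjugate i j - c i * w j ∈ Ideal.span {perPoly (Fin n) ℂ} := by
  intro h
  obtain ⟨k₃, hk₃⟩ : ∃ p : MvPolynomial (Fin 3 × Fin 3) ℂ, p = X (1, 1) * X (2, 2) + X (2, 1) * X (1, 2) :=
    ⟨_, rfl⟩
  obtain ⟨N₃, hN₃⟩ : ∃ M : Matrix (Fin 2) (Fin 2) (MvPolynomial (Fin 3 × Fin 3) ℂ),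
      M = !![X (0, 0), 1; X (0, 0) * k₃ - perPoly (Fin 3) ℂ, k₃] := ⟨_, rfl⟩
  have hdet : N₃.det = perPoly (Fin 3) ℂ := by
    rw [Matrix.det_fin_two, hN₃]
    simp
  obtain ⟨c, w, dc, dw, hsum, hc, hw, hmem⟩ := h 3 le_rfl 2 N₃ hdet
  have hadj : N₃.adjugate = !![k₃, -1; -(X (0, 0) * k₃ - perPoly (Fin 3) ℂ), X (0, 0)] := by
    rw [Matrix.adjugate_fin_two, hN₃]
    simp
  have low : ∀ q : MvPolynomial (Fin 3 × Fin 3) ℂ, q ∈ Ideal.span {perPoly (Fin 3) ℂ} →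
      q.totalDegree < 3 → q = 0 := fun q hq hd => eq_zero_of_mem_span_perPoly hq hd
  have h00 := hmem 0 0
  have h01 := hmem 0 1
  have h11 := hmem 1 1
  simp only [hadj, Matrix.of_apply, Matrix.cons_val', Matrix.cons_val_zero, Matrix.cons_val_one,
    Matrix.empty_val', Matrix.cons_val_fin_one] at h00 h01 h11
  have hk : k₃.totalDegree ≤ 2 := by
    rw [hk₃]
    refine (totalDegree_add _ _).trans (max_le ?_ ?_) <;>
      exact (totalDegree_mul _ _).trans (by simp [totalDegree_X])
  rcases (show dc = 0 ∨ dw = 0 by omega) with hdc | hdw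
  · subst hdc
    have hc0 : c 0 = C (coeff 0 (c 0)) := totalDegree_eq_zero_iff_eq_C.1 (Nat.le_zero.1 (hc 0))
    have hc1 : c 1 = C (coeff 0 (c 1)) := totalDegree_eq_zero_iff_eq_C.1 (Nat.le_zero.1 (hc 1))
    set a := coeff 0 (c 0)
    set b := coeff 0 (c 1)
    have hq : (C (-b) + C (-a) * X (0, 0) : MvPolynomial (Fin 3 × Fin 3) ℂ) ∈
        Ideal.span {perPoly (Fin 3) ℂ} := by
      have := Ideal.sub_mem _ (Ideal.mul_mem_left _ (C b) h01) (Ideal.mul_mem_left _ (C a) h11)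
      convert this using 1
      rw [hc0, hc1, C_neg, C_neg]
      ring
    have hq0 := low _ hq (by
      refine lt_of_le_of_lt ((totalDegree_add _ _).trans (max_le ?_ ?_)) (by norm_num : 1 < 3)
      · simp
      · exact (totalDegree_mul _ _).trans (by simp [totalDegree_X]))
    have hb : b = 0 := by
      simpa using congr_arg (eval fun _ : Fin 3 × Fin 3 => (0 : ℂ)) hq0
    have ha : a = 0 := by
      have := congr_arg (eval fun ij : Fin 3 × Fin 3 => if ij = (0, 0) then (1 : ℂ) else 0) hq0
      simpa [hb] using this
    have h1 : (1 : MvPolynomial (Fin 3 × Fin 3) ℂ) ∈ Ideal.span {perPoly (Fin 3) ℂ} := by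
      have := (Ideal.neg_mem_iff _).2 h01
      rw [hc0, ha] at this
      simpa using this
    exact one_notMem_span_perPoly (by norm_num) h1
  · subst hdw
    have hw0 : w 0 = C (coeff 0 (w 0)) := totalDegree_eq_zero_iff_eq_C.1 (Nat.le_zero.1 (hw 0))
    have hw1 : w 1 = C (coeff 0 (w 1)) := totalDegree_eq_zero_iff_eq_C.1 (Nat.le_zero.1 (hw 1))
    set a := coeff 0 (w 0)
    set b := coeff 0 (w 1)
    have hq : (C b * k₃ + C a : MvPolynomial (Fin 3 × Fin 3) ℂ) ∈ Ideal.span {perPoly (Fin 3) ℂ} := by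
      have := Ideal.sub_mem _ (Ideal.mul_mem_left _ (C b) h00) (Ideal.mul_mem_left _ (C a) h01)
      convert this using 1
      rw [hw0, hw1]
      ring
    have hq0 := low _ hq (by
      refine lt_of_le_of_lt ((totalDegree_add _ _).trans (max_le ?_ (by simp))) (by norm_num : 2 < 3)
      exact (totalDegree_mul _ _).trans (by simpa using hk))
    have ha : a = 0 := by
      simpa [hk₃] using congr_arg (eval fun _ : Fin 3 × Fin 3 => (0 : ℂ)) hq0
    have hb : b = 0 := by
      have := congr_arg (eval fun ij : Fin 3 × Fin 3 => if ij = (1, 1) ∨ ij = (2, 2) then (1 : ℂ) else 0) hq0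
      simpa [hk₃, ha] using this
    have h1 : (1 : MvPolynomial (Fin 3 × Fin 3) ℂ) ∈ Ideal.span {perPoly (Fin 3) ℂ} := by
      have := (Ideal.neg_mem_iff _).2 h01
      rw [hw1, hb] at this
      simpa using this
    exact one_notMem_span_perPoly (by norm_num) h1

end Summit.ValiantsHypothesis.Theorems.RankOneTrivialisationNegative
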